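import Summits.AtomisticToContinuum.FouriersLaw.Theorems.JunctionLocalityNonBallisticStubBulkWindowDynamicalMatchingAux2
import Summits.AtomisticToContinuum.FouriersLaw.Theorems.JunctionLocalityNonBallisticStubBulkWindowDynamicalMatchingAux3
import Summits.AtomisticToContinuum.FouriersLaw.Theorems.EmbeddedDrudeMourreAbelThermodynamicLimitDynamicalMatchingRadius

/-!
# Stub `stub_bulkWindowDynamicalMatching` (F1a) of line `drude-controls-conductance` (R2b) — crux
`JunctionLocality.NonBallistic` (stmt-AtomisticToContinuum-9127): THE TWO-DYNAMICS LIGHT CONE AT FIXED TIME FOR BULK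
WINDOWS, uniformly in `N` and in the anchor

Helper file (`--supports stmt-AtomisticToContinuum-9127`) proving the registered stub `stub_bulkWindowDynamicalMatching`
VERBATIM; nothing here closes the item.

For `P = pinnedChain ω₂ lam β γ` (all `> 0`), `T > 0`, the ANCHORED embedding `ι_{N,a}` (chain site `l` at `l - a`,
entered through its defining equation), `t ≥ 0`, an offset `x` and `ε > 0` there is `R₀` such that for all `R ≥ R₀`
and all `N`, `a` with `R + 1 ≤ a`, `a + R + 3 ≤ N` the bond current `j_x` of the embedded open-chain path at time `t`
and of the severed Hamiltonian flow of the box `{-R,…,R}` started from the same Gibbs configuration differ by more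
than `ε` with probability `≤ ε` under `gibbsMeasure N T ⊗ W`.

This is the anchored port of the LANDED centred statement `stub_centralWindowDynamicalMatching`
(`EmbeddedDrudeMourreAbelThermodynamicLimitDynamicalMatching.lean`, anchor `a = ⌊(N-1)/2⌋`, `2R + 4 ≤ N`): outside
the bad event (local energy `W_{0,R+1}(ι_{N,a} z) > lam R²/4` or some time-integrated squared momentum of the window
`|m - a| ≤ R+1` exceeds `R`; probability `O(1/R)` uniformly in `N` and `a`, parts 2–3 = `…Aux2`, `…Aux3`) both flows
keep the window positions in `[-(2+2t)√R, (2+2t)√R]`, so the anchored pathwise core (part 1 = `…Aux1`) bounds the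
discrepancy at the sites `x, x+1` by `O(R 4^{-(R-|x|)})` in the regime `2e√Θ t ≤ 2(R-|x|) - 1`, `Θ = O(R)`; the local
Lipschitz bound of `j_x` (`abs_bondCurrentZ_sub_le`) and the severed momentum bound `√(lam/2) R` give a current error
`O(R⁴4^{-R})`, and the anchor-free radius threshold `exists_radius_threshold` of the centred line makes regime,
current error `≤ ε` and probability `≤ ε` hold for `R ≥ R₀`. Every moment input is SITE-uniform, so `R₀` does not
depend on the anchor.

All statements proved; `[folklore]`. No definitions.
-/

noncomputable section

namespace Summit.AtomisticToContinuum.FouriersLaw.Theorems.NonBallistic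

open MeasureTheory ProbabilityTheory Set Filter Topology Function
open scoped NNReal ENNReal
open Literature.MathematicalPhysics.KineticTheory Literature.MathematicalPhysics.KineticTheory.HeatConduction
open Literature.Probability.Process OscillatorChain
open Summit.AtomisticToContinuum.FouriersLaw.Theorems.AbelThermodynamicLimit.LoomisCompactHorizonWitness
open Summit.AtomisticToContinuum.FouriersLaw.Theorems.NonBallistic.BulkWindowMatching

/-- **Registered stub `stub_bulkWindowDynamicalMatching`** (F1a, stub 13 of line `drude-controls-conductance`, R2b) —
THE TWO-DYNAMICS LIGHT CONE AT FIXED TIME FOR BULK WINDOWS, uniformly in `N` and in the anchor `a`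
(see the module docstring for the scheme; anchored port of `stub_centralWindowDynamicalMatching`). [folklore] -/
theorem stub_bulkWindowDynamicalMatching :
    ∀ ω₂ lam β γ : ℝ, 0 < ω₂ → 0 < lam → 0 < β → 0 < γ → ∀ T : ℝ, 0 < T →
      ∀ (hB1 : (pinnedChain ω₂ lam β γ).CondB1)
        (ι : (N : ℕ) → ℕ → PhaseSpace N → ChainConfig),
        (∀ (N a : ℕ) (z : PhaseSpace N) (i : ℤ),
          ι N a z i = if h : 0 ≤ i + (a : ℤ) ∧ i + (a : ℤ) < N then
            (z.1 ⟨(i + (a : ℤ)).toNat, by omega⟩, z.2 ⟨(i + (a : ℤ)).toNat, by omega⟩)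
            else (0, 0)) →
      ∀ (t : ℝ), 0 ≤ t → ∀ (x : ℤ) (ε : ℝ), 0 < ε → ∃ R₀ : ℕ, ∀ R : ℕ, R₀ ≤ R →
        ∀ N a : ℕ, R + 1 ≤ a → a + R + 3 ≤ N →
        (((pinnedChain ω₂ lam β γ).gibbsMeasure N T).prod wienerPair)
          {q : PhaseSpace N × WienerPair |
            ε < |(pinnedChain ω₂ lam β γ).bondCurrentZ
                  (ι N a ((pinnedChain ω₂ lam β γ).solMap N T T t q.1 (pairPath q.2))) x -
                (pinnedChain ω₂ lam β γ).bondCurrentZ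
                  (OscillatorChain.severedFlow hB1 (Finset.Icc (-(R : ℤ)) R) t (ι N a q.1)) x|} ≤ ENNReal.ofReal ε := by
  -- adapted from `LoomisCompactHorizonWitness.stub_centralWindowDynamicalMatching` (anchor `(N-1)/2`, `2R+4 ≤ N`)
  intro ω₂ lam β γ hω hl hβ hγ T hT hB1 ι hι t ht x ε hε
  -- the `N`- and anchor-uniform energy constant and the radius threshold
  obtain ⟨C, hCtop, hC⟩ := bulk_exists_lintegral_bmLocalEnergy_le hω hl hβ hT γ ι hι
  obtain ⟨R₀, hR₀⟩ := exists_radius_threshold hω.le hl hβ.le ht x hε (Cr := C.toReal) (Kt := 2027025 * T ^ 8 * t ^ 8)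
    ENNReal.toReal_nonneg (by positivity)
  refine ⟨R₀, fun R hR N a hRa haN => ?_⟩
  obtain ⟨hRx, hR1, hreg, herr, hprob⟩ := hR₀ R hR
  haveI hμ : IsProbabilityMeasure ((pinnedChain ω₂ lam β γ).gibbsMeasure N T) :=
    pinnedChain_isProbabilityMeasure_gibbsMeasure hω hl.le hβ.le γ N hT
  -- the bad event
  set Bad : Set (PhaseSpace N × WienerPair) :=
    {q | lam * (R : ℝ) ^ 2 / 4 < (pinnedChain ω₂ lam β γ).bmLocalEnergy 0 (R + 1) (ι N a q.1)} ∪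
      ⋃ m ∈ (Finset.univ.filter fun m : Fin N =>
          -((R : ℤ) + 1) ≤ (m : ℤ) - (a : ℤ) ∧ (m : ℤ) - (a : ℤ) ≤ (R : ℤ) + 1),
        {q | (R : ℝ) < ∫ r in (0:ℝ)..t, ((pinnedChain ω₂ lam β γ).solMap N T T r q.1 (pairPath q.2)).2 m ^ 2}
    with hBad
  -- on the complement of the bad event the currents are `ε`-close
  have hgood : ∀ q : PhaseSpace N × WienerPair, q ∉ Bad →
      |(pinnedChain ω₂ lam β γ).bondCurrentZ (ι N a ((pinnedChain ω₂ lam β γ).solMap N T T t q.1 (pairPath q.2))) x -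
        (pinnedChain ω₂ lam β γ).bondCurrentZ (severedFlow hB1 (Finset.Icc (-(R : ℤ)) R) t (ι N a q.1)) x| ≤ ε := by
    intro q hq
    simp only [hBad, Set.mem_union, Set.mem_setOf_eq, Set.mem_iUnion, not_or, not_lt, not_exists] at hq
    obtain ⟨hW, hX⟩ := hq
    have hX' : ∀ m : Fin N, -((R : ℤ) + 1) ≤ (m : ℤ) - (a : ℤ) → (m : ℤ) - (a : ℤ) ≤ (R : ℤ) + 1 →
        ∫ r in (0:ℝ)..t, ((pinnedChain ω₂ lam β γ).solMap N T T r q.1 (pairPath q.2)).2 m ^ 2 ≤ R := by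
      intro m h1 h2
      have h := hX m
      simp only [Finset.mem_filter, Finset.mem_univ, true_and] at h
      exact h ⟨h1, h2⟩
    obtain ⟨hbox, hpsev⟩ := bulk_good_event_bounds hω hl hβ.le hγ.le hB1 ι hι hRa haN hR1 T ht q hW hX'
    -- the open path in `chainFlow` form
    have hsol : ∀ s : ℝ, (pinnedChain ω₂ lam β γ).solMap N T T s q.1 (pairPath q.2) =
        (pinnedChain ω₂ lam β γ).chainFlow N q.1 (chainNoise N (Real.sqrt (2 * (pinnedChain ω₂ lam β γ).γ * T))
          (Real.sqrt (2 * (pinnedChain ω₂ lam β γ).γ * T)) (pairPath q.2)) s := fun s => rfl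
    set ρ : ℝ := (2 + 2 * t) * Real.sqrt R with hρdef
    have hcore := fun (i : ℤ) (hi1 : x ≤ i) (hi2 : i ≤ x + 1) =>
      bulk_core_estimate hω hl.le hβ.le hγ.le hB1 ι hι q.1 _ _ (pairPath q.2) hRa haN (ρ := ρ) ht hbox x hRx hreg i
        hi1 hi2
    rw [hsol t]
    set X := ι N a ((pinnedChain ω₂ lam β γ).chainFlow N q.1 (chainNoise N
      (Real.sqrt (2 * (pinnedChain ω₂ lam β γ).γ * T)) (Real.sqrt (2 * (pinnedChain ω₂ lam β γ).γ * T))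
      (pairPath q.2)) t) with hXdef
    set Y := severedFlow hB1 (Finset.Icc (-(R : ℤ)) R) t (ι N a q.1) with hYdef
    obtain ⟨hq0, hp0⟩ := hcore x le_rfl (by omega)
    obtain ⟨hq1, hp1⟩ := hcore (x + 1) (by omega) le_rfl
    have hxR : x ∈ Finset.Icc (-(R : ℤ)) R := by simp only [Finset.mem_Icc]; omega
    have hxR' : x + 1 ∈ Finset.Icc (-(R : ℤ)) R := by simp only [Finset.mem_Icc]; omega
    obtain ⟨hX0, hY0⟩ := hbox t ⟨ht, le_rfl⟩ x (by omega) (by omega)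
    obtain ⟨hX1, hY1⟩ := hbox t ⟨ht, le_rfl⟩ (x + 1) (by omega) (by omega)
    have hj := abs_bondCurrentZ_sub_le ω₂ lam hβ.le γ (σ₁ := X) (σ₂ := Y) (x := x) hX0 hX1 hY0 hY1
      (hpsev x hxR) (hpsev (x + 1) hxR') hp0 hp1 hq0 hq1
    exact hj.trans herr
  -- the probability of the bad event
  have hsub : {q : PhaseSpace N × WienerPair |
      ε < |(pinnedChain ω₂ lam β γ).bondCurrentZ (ι N a ((pinnedChain ω₂ lam β γ).solMap N T T t q.1 (pairPath q.2))) x -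
        (pinnedChain ω₂ lam β γ).bondCurrentZ (severedFlow hB1 (Finset.Icc (-(R : ℤ)) R) t (ι N a q.1)) x|} ⊆ Bad := by
    intro q hq
    by_contra h
    exact absurd (hgood q h) (not_le.2 hq)
  refine (measure_mono hsub).trans ((bulk_bad_event_le hω hl hβ hγ hT ι hι hC hRa haN hR1 ht).trans ?_)
  -- convert the `ℝ≥0∞` bound
  have hr1 : (1 : ℝ) ≤ R := by exact_mod_cast hR1
  have hr0 : (0 : ℝ) < R := by linarith
  have hE0 : 0 < lam * (R : ℝ) ^ 2 / 4 := by positivity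
  have e1 : (2 * (R : ℝ≥0∞) + 3) = ENNReal.ofReal (2 * R + 3) := by
    rw [ENNReal.ofReal_add (by positivity) (by norm_num), ENNReal.ofReal_mul (by norm_num), ENNReal.ofReal_ofNat,
      ENNReal.ofReal_natCast, ENNReal.ofReal_ofNat]
  have e2 : C = ENNReal.ofReal C.toReal := (ENNReal.ofReal_toReal hCtop).symm
  rw [e1, e2, ← ENNReal.ofReal_mul (by positivity), ← ENNReal.ofReal_div_of_pos hE0,
    ← ENNReal.ofReal_mul (by positivity), ← ENNReal.ofReal_add (by positivity) (by positivity)]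
  exact ENNReal.ofReal_le_ofReal hprob

end Summit.AtomisticToContinuum.FouriersLaw.Theorems.NonBallistic

end
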